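import Summits.CriticalPhenomena.PercolationContinuityZ3.Theorems.PercNearOneGluingNoHeavyQuantIndepBlobGapLightPairs
import HarnessLib

/-!
# QUANT lane R8, T-DIB: two sub-floor blobs whose DISCOUNTED credits per unit size sum to at least one — the pair odds
# condition and the closure bound (the algebraic cores of cells C5/C7 of the two-light chord certificate)

builds on p205010 (kernel theorem, internal audit signed; external expert review pending)

Support file (`--supports stmt-CriticalPhenomena-4575`), QUANT lane seat prim-quant-p1 (gen 12); memo
`run/shared/lean/prim/quant/P1-SURPLUS.md` §23.5.  Theorems only; no definitions, no sorries, standard axioms.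

In Conjecture DIB\* (`…QuantDIBStar`) a sub-floor blob with gate `g ∈ [x², x)` carries the credit rate
`κ_x(g) = (g − x²)/(1 − x)` per unit size.  For two such blobs with gates `G, g` the condition `κ_x(G) + κ_x(g) ≥ 1`, i.e.
`(G − x²) + (g − x²) ≥ 1 − x`, is forced whenever the pair alone must supply more than `max(size)` units of credit (e.g. the cells
of the two-light chord certificate with `n₂ ≤ j`, P1-SURPLUS §23.5, where the light credit exceeds `j`).  Two consequences, for
`1/2 ≤ x < 1`:

* `Quant.IndepBlob.lightPair_odds_of_unit_credit` — **the pair odds condition** `x(1−G)(1−g) ≤ (1−x)·G·g`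
  (`odds(G)·odds(g) ≥ odds(x)`), the hypothesis of p1 g11's light-pair row `IndepBlob.tail_ge_of_lightPair` and of lead g16's
  `pairDecomp`; identity used: with `u = G − x²`, `v = g − x²`, `s = u + v`, `ε = 1 − x`,
  `(1−x)Gg − x(1−G)(1−g) = (2x−1)(2x²+x+1)(2xε − s)/4 + x(s − ε) + (2x−1)(s − ε)(2xε − s)/4 + (2x−1)((u−v)²)/4`,
  every term nonnegative for `ε ≤ s ≤ 2xε` (equality only in the limit `x ↓ 1/2`).
* `Quant.IndepBlob.lightPair_closure_of_unit_credit` — **the closure bound** `(1−G)(1−g) ≤ (1−x)/2`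
  (`2 − (1−x)(2x+1)² = (2x−1)²(x+1) ≥ 0`).
* `Quant.IndepBlob.tail_ge_of_lightPair_unit_credit` — the light-pair row with the odds hypothesis replaced by unit credit:
  all blobs heavy except `ℓ₁ ≠ ℓ₂` with gates in `[x², x]` and `(p ℓ₁ − x²) + (p ℓ₂ − x²) ≥ 1 − x`, `a ℓ₁ ≤ a ℓ₂`,
  `2j + 1 + a ℓ₂ ≤ Σ a + a ℓ₁` ⟹ `x ≤ P(N ≥ j+1)`.
Numerics (`prim-quant-p1-g12/evidence/num/`, 5·10⁶ exact samples): both inequalities hold with minimum `→ 0⁺` as `x ↓ 1/2`, `G, g ↓ 1/2`.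
[cite: KozmaNitzan2024, Conjecture 3 (p. 15)] (the gluing rows served); the lemmas are [this work].
-/

namespace Summit.CriticalPhenomena.PercolationContinuityZ3.Theorems

namespace Quant

namespace IndepBlob

open Finset

/-- **Unit discounted credit forces the pair odds condition.**  For `1/2 ≤ x < 1` and two gates `G, g ∈ [x², x]` with
`(G − x²) + (g − x²) ≥ 1 − x` (the two `κ_x`-credit rates sum to at least one): `x(1−G)(1−g) ≤ (1−x)·G·g`. [this work] -/
theorem lightPair_odds_of_unit_credit (x G g : ℝ) (hx : 1 / 2 ≤ x) (hx1 : x < 1)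
    (hGlo : x ^ 2 ≤ G) (hGx : G ≤ x) (hglo : x ^ 2 ≤ g) (hgx : g ≤ x)
    (hcr : 1 - x ≤ (G - x ^ 2) + (g - x ^ 2)) :
    x * (1 - G) * (1 - g) ≤ (1 - x) * G * g := by
  set u : ℝ := G - x ^ 2 with hu
  set v : ℝ := g - x ^ 2 with hv
  have hu0 : 0 ≤ u := by rw [hu]; linarith
  have hv0 : 0 ≤ v := by rw [hv]; linarith
  have hux : u ≤ x * (1 - x) := by rw [hu]; nlinarith
  have hvx : v ≤ x * (1 - x) := by rw [hv]; nlinarith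
  have hs1 : 1 - x ≤ u + v := hcr
  have hs2 : u + v ≤ 2 * x * (1 - x) := by linarith
  have h2x : 0 ≤ 2 * x - 1 := by linarith
  have hpoly : 0 ≤ 2 * x ^ 2 + x + 1 := by nlinarith
  -- the identity
  have key : (1 - x) * G * g - x * (1 - G) * (1 - g) =
      (2 * x - 1) * (2 * x ^ 2 + x + 1) * (2 * x * (1 - x) - (u + v)) / 4 + x * ((u + v) - (1 - x)) +
      (2 * x - 1) * ((u + v) - (1 - x)) * (2 * x * (1 - x) - (u + v)) / 4 + (2 * x - 1) * (u - v) ^ 2 / 4 := by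
    have hG : G = x ^ 2 + u := by rw [hu]; ring
    have hg : g = x ^ 2 + v := by rw [hv]; ring
    rw [hG, hg]; ring
  have t1 : 0 ≤ (2 * x - 1) * (2 * x ^ 2 + x + 1) * (2 * x * (1 - x) - (u + v)) / 4 :=
    div_nonneg (mul_nonneg (mul_nonneg h2x hpoly) (by linarith)) (by norm_num)
  have t2 : 0 ≤ x * ((u + v) - (1 - x)) := mul_nonneg (by linarith) (by linarith)
  have t3 : 0 ≤ (2 * x - 1) * ((u + v) - (1 - x)) * (2 * x * (1 - x) - (u + v)) / 4 :=
    div_nonneg (mul_nonneg (mul_nonneg h2x (by linarith)) (by linarith)) (by norm_num)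
  have t4 : 0 ≤ (2 * x - 1) * (u - v) ^ 2 / 4 := div_nonneg (mul_nonneg h2x (sq_nonneg _)) (by norm_num)
  linarith [key, t1, t2, t3, t4]

/-- **Unit discounted credit bounds the joint closure probability.**  For `1/2 ≤ x < 1` and gates `G, g ≤ x` with
`(G − x²) + (g − x²) ≥ 1 − x`: `(1−G)(1−g) ≤ (1−x)/2` (so in particular `1 − (1−G)(1−g) ≥ x`). [this work] -/
theorem lightPair_closure_of_unit_credit (x G g : ℝ) (hx : 1 / 2 ≤ x) (hx1 : x < 1)
    (hGx : G ≤ x) (hgx : g ≤ x) (hcr : 1 - x ≤ (G - x ^ 2) + (g - x ^ 2)) :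
    (1 - G) * (1 - g) ≤ (1 - x) / 2 := by
  set u : ℝ := G - x ^ 2 with hu
  set v : ℝ := g - x ^ 2 with hv
  have hux : u ≤ x * (1 - x) := by rw [hu]; nlinarith
  have hvx : v ≤ x * (1 - x) := by rw [hv]; nlinarith
  have hs1 : 1 - x ≤ u + v := hcr
  -- `(1−G)(1−g) = (ε(1+x) − s/2)² − (u−v)²/4`, `s = u+v`, and `ε ≤ ε(1+x) − s/2 ≤ ε(x + 1/2)`
  have key : (1 - G) * (1 - g) =
      ((1 - x) * (1 + x) - (u + v) / 2) ^ 2 - (u - v) ^ 2 / 4 := by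
    have hG : G = x ^ 2 + u := by rw [hu]; ring
    have hg : g = x ^ 2 + v := by rw [hv]; ring
    rw [hG, hg]; ring
  have ht0 : 0 ≤ (1 - x) * (1 + x) - (u + v) / 2 := by nlinarith
  have ht1 : (1 - x) * (1 + x) - (u + v) / 2 ≤ (1 - x) * (x + 1 / 2) := by linarith
  have hsq : ((1 - x) * (1 + x) - (u + v) / 2) ^ 2 ≤ ((1 - x) * (x + 1 / 2)) ^ 2 := by
    nlinarith [ht0, ht1]
  -- `ε²(x + 1/2)² ≤ ε/2` since `2 − (1−x)(2x+1)² = (2x−1)²(x+1) ≥ 0`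
  have hpoly : ((1 - x) * (x + 1 / 2)) ^ 2 ≤ (1 - x) / 2 := by
    have h1 : ((1 - x) * (x + 1 / 2)) ^ 2 = (1 - x) * ((1 - x) * (2 * x + 1) ^ 2 / 4) := by ring
    have h2 : (1 - x) * (2 * x + 1) ^ 2 = 2 - (2 * x - 1) ^ 2 * (x + 1) := by ring
    rw [h1, h2]
    have h3 : 0 ≤ (2 * x - 1) ^ 2 * (x + 1) := mul_nonneg (sq_nonneg _) (by linarith)
    nlinarith [h3]
  nlinarith [key, hsq, hpoly, sq_nonneg (u - v)]

/-- **The light-pair row under unit credit.**  Gates in `[0,1]`, floor `1/2 ≤ x < 1`; two blobs `ℓ₁ ≠ ℓ₂` with gates in `[x², x]`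
whose discounted credits per unit size sum to at least one, `(p ℓ₁ − x²) + (p ℓ₂ − x²) ≥ 1 − x`; `a ℓ₁ ≤ a ℓ₂`; every other blob
heavy (`x ≤ p k`); and `2j + 1 + a ℓ₂ ≤ Σ a + a ℓ₁`.  Then `x ≤ P(N ≥ j+1)`.  (`tail_ge_of_lightPair` + `lightPair_odds_of_unit_credit`.)
[this work] -/
theorem tail_ge_of_lightPair_unit_credit {κ : Type*} [Fintype κ] [DecidableEq κ] (p : κ → ℝ) (a : κ → ℕ) (x : ℝ)
    (hx : 1 / 2 ≤ x) (hx1 : x < 1) (hp0 : ∀ i, 0 ≤ p i) (hp1 : ∀ i, p i ≤ 1) (ℓ₁ ℓ₂ : κ) (hne : ℓ₁ ≠ ℓ₂)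
    (hbB : a ℓ₁ ≤ a ℓ₂) (h1lo : x ^ 2 ≤ p ℓ₁) (h1hi : p ℓ₁ ≤ x) (h2lo : x ^ 2 ≤ p ℓ₂) (h2hi : p ℓ₂ ≤ x)
    (hcr : 1 - x ≤ (p ℓ₁ - x ^ 2) + (p ℓ₂ - x ^ 2))
    (hheavy : ∀ k, k ≠ ℓ₁ → k ≠ ℓ₂ → x ≤ p k) (j : ℕ)
    (hsize : 2 * j + 1 + a ℓ₂ ≤ (∑ k, a k) + a ℓ₁) :
    x ≤ ∑ s : Finset κ, (∏ i, (if i ∈ s then p i else 1 - p i)) * (if j + 1 ≤ ∑ i ∈ s, a i then (1 : ℝ) else 0) :=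
  tail_ge_of_lightPair p a x hx hx1 hp0 hp1 ℓ₁ ℓ₂ hne hbB
    (lightPair_odds_of_unit_credit x (p ℓ₁) (p ℓ₂) hx hx1 h1lo h1hi h2lo h2hi hcr) hheavy j hsize

end IndepBlob

end Quant

end Summit.CriticalPhenomena.PercolationContinuityZ3.Theorems
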